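import Summits.HodgeConjecture.HodgeConjecture.Theorems.F0P3cStCharTSHyperbolicSet               -- ★ p849676∕ED. 2 (F0P3a-p05 (g19)): `isRegularElt_of_mem_hyperbolicSet`; brings ★ `TorusDefs.hyperbolicSet`
import Summits.HodgeConjecture.HodgeConjecture.Theorems.F0P3cStCharTSEllipticCriterionSimpleRoot   -- ★ p849796 (this seat) (E2′) + cone ★ p849769 (E2), ★ p849661 (E1)
import Summits.HodgeConjecture.HodgeConjecture.Theorems.F0P3cStCharTSWeylHypCM                   -- ★ p849636 (LH2-p01 (g3)): `isUnit_of_ne_zero_of_nonsplit` (reused, not restated)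
import HarnessLib

/-!
# F0 · P3c · line LH6 «StCharTS» — «HYP-EIG★»: THE EIGENVALUE CHARACTERISATION OF THE REGULAR HYPERBOLIC SET `Ω = hyperbolicSet L v ⊆ U(Φ₃)(L⁺_v)`
# `γ ∈ Ω ↔ γ regular ∧ ∃ α ∈ L ⊗ L⁺_v, charpoly(γ)(α) = 0 ∧ α σ(α) ≠ 1` [Rogawski1990 §12.5 p. 182; §3.6; §3.1 p. 19]

Cell `pub/hodgecm-mathlib`, crux H413 = `stmt-HodgeConjecture-24833` (`--supports` lane, helper), route HCCMUnconditional; seat F0P2-p02 (g15); announced DEFAULT brick (F0∕P3b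
2026-09-02T07:02Z, «ELL-CRIT★» sequel (i) offered 06:22Z∕06:32Z∕06:50Z).  THEOREMS ONLY, sorry-free, ★-only imports; no definition ∕ instance ∕ notation ∕ named fact.

THE STATEMENT.  `Ω := hyperbolicSet L v = {γ | ∃ t ∈ T regular, IsConj t γ}` (★ `F0P3cStCharTSTorusDefs`, LH6-p01 (g2)), `T = (cmBorelTriple L 3 v).M = torusU σ Φ₃` the diagonal
torus of `G = U(Φ₃)(L⁺_v)` (carrier `Gqs L v`, `σ = conjLocal`, coordinates in `L ⊗ L⁺_v = Π_{w ∣ v} L_w`).  Then: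
* `exists_isRoot_of_mem_hyperbolicSet` — `γ ∈ Ω ⇒ ∃ α, charpoly(γ)(α) = 0 ∧ α σ(α) ≠ 1` (★ (E1) `exists_isRoot_of_conj_mem_torusU`; any place);
* `mem_hyperbolicSet_of_isRoot` — at a NON-SPLIT `v` (`hns`): `γ` regular with such a root ⇒ `γ ∈ Ω` (★ (E2) `exists_conj_mem_torusU_of_isRoot_of_isUnit` on the field-like
  carrier, ★ `F0P3cStCharTSWeylHypCM.isUnit_of_ne_zero_of_nonsplit`);
* `mem_hyperbolicSet_of_isRoot_of_derivative_ne_zero` — the same from a SIMPLE root, NO regularity assumed (★ (E2′));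
* **`mem_hyperbolicSet_iff`** — the dichotomy of [Rogawski1990, §12.5]: on the regular set, «hyperbolic» (conjugate into the split torus) ⟺ «has a rational eigenvalue
  off the norm-one torus `{α σ(α) = 1}`»; its negation on the regular set is the elliptic set `ellG` of the (S-𝔇) datum.
HONEST LABEL: HC_CM is proved only modulo the 7 printed citations (2 remaining: hLiu418 = `stmt-HodgeConjecture-24832`, h413 = `stmt-HodgeConjecture-24833`) until rung 0 closes;
count-neutral (TOR)-road algebra, closes no organ.

## References
* [Rogawski1990] J. D. Rogawski, *Automorphic Representations of Unitary Groups in Three Variables*, Ann. of Math. Stud. 123 (1990), §12.5 p. 182 (regular hyperbolic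
  set, split torus), §3.6 (elliptic elements), §3.1 p. 19 (regular elements), §1.10 p. 9 (`M`).
-/

set_option autoImplicit false
-- the mandated namespace has the single-problem summit's repeated segment (`HodgeConjecture.HodgeConjecture`)
set_option linter.dupNamespace false

noncomputable section

open NumberField IsDedekindDomain Matrix Polynomial
open scoped MatrixGroups
open Literature.NumberTheory.Rogawski1990 Literature.NumberTheory.Automorphic Literature.NumberTheory.Automorphic.UnitaryGroup
open Summit.HodgeConjecture.HodgeConjecture.Cruxes.H413.F0P3cStCharTSTorusDefs
open Summit.HodgeConjecture.HodgeConjecture.Cruxes.H413.F0P3cStCharTSHyperbolicSet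
open Summit.HodgeConjecture.HodgeConjecture.Cruxes.H413.F0P3cStCharTSEllipticCriterion
open Summit.HodgeConjecture.HodgeConjecture.Cruxes.H413.F0P3cStCharTSEllipticCriterionConverse
open Summit.HodgeConjecture.HodgeConjecture.Cruxes.H413.F0P3cStCharTSEllipticCriterionSimpleRoot

namespace Summit.HodgeConjecture.HodgeConjecture.Cruxes.H413.F0P3cStCharTSHyperbolicSetEigen

variable (L : Type) [Field L] [NumberField L] [IsCMField L] (v : HeightOneSpectrum (𝓞 ↥(maximalRealSubfield L)))

/-! ## §1 `Ω ⇒` eigenvalue off the norm-one torus (any place) -/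

set_option maxHeartbeats 1600000 in  -- statement-level `whnf` on the CM carriers (`Gqs`, `LocalRing`)
set_option synthInstance.maxHeartbeats 400000 in  -- first `GL (LocalRing L v) → Matrix` coercion of the module (cold instance cache)
/-- **`γ ∈ Ω ⇒ γ` has an eigenvalue `α ∈ L ⊗ L⁺_v` with `α σ(α) ≠ 1`**: `γ = x t x⁻¹` with `t ∈ T` regular; ★ (E1) `exists_isRoot_of_mem_torusU` gives such an `α` for
`t`, and `charpoly γ = charpoly t` (conjugation).  The carrier `Π_{w ∣ v} L_w` is a nontrivial commutative ring; no non-split hypothesis. [cite: Rogawski1990, §12.5 p. 182; §1.10 p. 9] -/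
theorem exists_isRoot_of_mem_hyperbolicSet {γ : Gqs L v} (hγ : γ ∈ hyperbolicSet L v) :
    ∃ α : LocalRing L v,
      Polynomial.IsRoot ((γ.val : GL (Fin 3) (LocalRing L v)) : Matrix (Fin 3) (Fin 3) (LocalRing L v)).charpoly α ∧
        α * conjLocal L (IsCMField.complexConj L) v α ≠ 1 := by
  obtain ⟨t, ht, hc⟩ := hγ
  obtain ⟨x, hx⟩ := isConj_iff.1 hc
  obtain ⟨α, hα, hne⟩ := exists_isRoot_of_mem_torusU (conjLocal L (IsCMField.complexConj L) v) (cmLocalForm_eq_over L 3 v) t.2 ht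
  refine ⟨α, ?_, hne⟩
  -- `charpoly γ = charpoly (x t x⁻¹) = charpoly t`
  have e : ((γ.val : GL (Fin 3) (LocalRing L v)) : Matrix (Fin 3) (Fin 3) (LocalRing L v)).charpoly =
      ((((t : ↥(unitaryGroupOfForm (conjLocal L (IsCMField.complexConj L) v) (cmLocalForm L 3 v))) : GL (Fin 3) (LocalRing L v)) :
        Matrix (Fin 3) (Fin 3) (LocalRing L v))).charpoly := by
    rw [← hx, Subgroup.coe_mul, Subgroup.coe_mul, InvMemClass.coe_inv, Units.val_mul, Units.val_mul, Matrix.coe_units_inv, Matrix.charpoly_units_conj]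
  rw [e]
  exact hα

/-! ## §2 Eigenvalue off the norm-one torus `⇒ Ω`, at a non-split place -/

set_option maxHeartbeats 1600000 in  -- statement-level `whnf` on the CM carriers
/-- Packaging a torus conjugate as a member of `Ω`: if `x γ x⁻¹ ∈ T` and `γ` is regular then `γ ∈ hyperbolicSet` (witness `t := x γ x⁻¹`, regular by conjugation,
`IsConj t γ` by `x⁻¹`). [cite: Rogawski1990, §12.5 p. 182] -/
theorem mem_hyperbolicSet_of_conj_mem_torusU {γ x : ↥(unitaryGroupOfForm (conjLocal L (IsCMField.complexConj L) v) (cmLocalForm L 3 v))}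
    (hx : x * γ * x⁻¹ ∈ torusU (conjLocal L (IsCMField.complexConj L) v) (cmLocalForm L 3 v))
    (hreg : IsRegularElt (γ : GL (Fin 3) (LocalRing L v))) : (γ : Gqs L v) ∈ hyperbolicSet L v := by
  refine ⟨⟨x * γ * x⁻¹, hx⟩, (isRegularElt_coe_conj_iff (conjLocal L (IsCMField.complexConj L) v) (cmLocalForm L 3 v) γ x).2 hreg, isConj_iff.2 ⟨x⁻¹, ?_⟩⟩
  show x⁻¹ * (x * γ * x⁻¹) * x⁻¹⁻¹ = γ
  group

set_option maxHeartbeats 1600000 in  -- statement-level `whnf` on the CM carriers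
/-- **Regular with an eigenvalue `α`, `α σ(α) ≠ 1` ⇒ `γ ∈ Ω`** (non-split `v`): ★ (E2) `exists_conj_mem_torusU_of_isRoot_of_isUnit` on the field-like carrier (`σ` involutive by ★
`conjLocal_conjLocal_cm`, `Φ₃ = cmLocalForm L 3 v` by ★ `cmLocalForm_eq_over`). [cite: Rogawski1990, §12.5 p. 182; §3.6] -/
theorem mem_hyperbolicSet_of_isRoot (hns : ∀ w : PlacesOver L v, IsCMField.complexConj L • w.1 = w.1) {γ : Gqs L v}
    (hreg : IsRegularElt (γ.val : GL (Fin 3) (LocalRing L v))) {α : LocalRing L v}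
    (hα : ((γ.val : GL (Fin 3) (LocalRing L v)) : Matrix (Fin 3) (Fin 3) (LocalRing L v)).charpoly.IsRoot α)
    (hne : α * conjLocal L (IsCMField.complexConj L) v α ≠ 1) : γ ∈ hyperbolicSet L v := by
  obtain ⟨x, hx, -⟩ := exists_conj_mem_torusU_of_isRoot_of_isUnit (conjLocal L (IsCMField.complexConj L) v) (F0P3cStCharTSWeylHypCM.isUnit_of_ne_zero_of_nonsplit L v hns)
    (conjLocal_conjLocal_cm L v) (cmLocalForm_eq_over L 3 v)
    (γ := (γ : ↥(unitaryGroupOfForm (conjLocal L (IsCMField.complexConj L) v) (cmLocalForm L 3 v)))) hreg hα hne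
  exact mem_hyperbolicSet_of_conj_mem_torusU L v hx hreg

set_option maxHeartbeats 1600000 in  -- statement-level `whnf` on the CM carriers
/-- **SIMPLE root `α`, `α σ(α) ≠ 1` ⇒ `γ ∈ Ω`, NO regularity assumed** (non-split `v`): ★ (E2′) `exists_conj_mem_torusU_of_isRoot_of_derivative_ne_zero_of_isUnit` +
`isRegularElt_of_isRoot_of_derivative_ne_zero_of_isUnit` (regularity is an output). [cite: Rogawski1990, §12.5 p. 182; §3.1 p. 19] -/
theorem mem_hyperbolicSet_of_isRoot_of_derivative_ne_zero (hns : ∀ w : PlacesOver L v, IsCMField.complexConj L • w.1 = w.1) {γ : Gqs L v}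
    {α : LocalRing L v} (hα : ((γ.val : GL (Fin 3) (LocalRing L v)) : Matrix (Fin 3) (Fin 3) (LocalRing L v)).charpoly.IsRoot α)
    (hα' : (derivative ((γ.val : GL (Fin 3) (LocalRing L v)) : Matrix (Fin 3) (Fin 3) (LocalRing L v)).charpoly).eval α ≠ 0)
    (hne : α * conjLocal L (IsCMField.complexConj L) v α ≠ 1) : γ ∈ hyperbolicSet L v := by
  have hR := F0P3cStCharTSWeylHypCM.isUnit_of_ne_zero_of_nonsplit L v hns
  obtain ⟨x, hx, -⟩ := exists_conj_mem_torusU_of_isRoot_of_derivative_ne_zero_of_isUnit (conjLocal L (IsCMField.complexConj L) v) hR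
    (conjLocal_conjLocal_cm L v) (cmLocalForm_eq_over L 3 v)
    (γ := (γ : ↥(unitaryGroupOfForm (conjLocal L (IsCMField.complexConj L) v) (cmLocalForm L 3 v)))) hα hα' hne
  exact mem_hyperbolicSet_of_conj_mem_torusU L v hx
    (isRegularElt_of_isRoot_of_derivative_ne_zero_of_isUnit (conjLocal L (IsCMField.complexConj L) v) hR (conjLocal_conjLocal_cm L v)
      (cmLocalForm_eq_over L 3 v) (γ := (γ : ↥(unitaryGroupOfForm (conjLocal L (IsCMField.complexConj L) v) (cmLocalForm L 3 v)))) hα hα' hne)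

/-! ## §3 The dichotomy -/

set_option maxHeartbeats 1600000 in  -- statement-level `whnf` on the CM carriers
/-- **THE EIGENVALUE CHARACTERISATION OF `Ω`** (non-split `v`): `γ ∈ hyperbolicSet L v ↔ γ` is regular and its characteristic polynomial has a root `α ∈ L ⊗ L⁺_v` with
`α σ(α) ≠ 1`.  On the regular set the negation of the right-hand side («every rational eigenvalue lies on the norm-one torus») is the elliptic condition of the §12.5
datum. [cite: Rogawski1990, §12.5 p. 182; §3.6; §3.1 p. 19] -/
theorem mem_hyperbolicSet_iff (hns : ∀ w : PlacesOver L v, IsCMField.complexConj L • w.1 = w.1) (γ : Gqs L v) :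
    γ ∈ hyperbolicSet L v ↔ IsRegularElt (γ.val : GL (Fin 3) (LocalRing L v)) ∧
      ∃ α : LocalRing L v,
        Polynomial.IsRoot ((γ.val : GL (Fin 3) (LocalRing L v)) : Matrix (Fin 3) (Fin 3) (LocalRing L v)).charpoly α ∧
          α * conjLocal L (IsCMField.complexConj L) v α ≠ 1 :=
  ⟨fun hγ => ⟨isRegularElt_of_mem_hyperbolicSet L v hγ, exists_isRoot_of_mem_hyperbolicSet L v hγ⟩,
    fun h => by
      obtain ⟨hreg, α, hα, hne⟩ := h
      exact mem_hyperbolicSet_of_isRoot L v hns hreg hα hne⟩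

set_option maxHeartbeats 1600000 in  -- statement-level `whnf` on the CM carriers
/-- **Regular and NOT hyperbolic ⇒ every rational eigenvalue lies on the norm-one torus** (`α σ(α) = 1`) — the elliptic side of the dichotomy, non-split `v`.
[cite: Rogawski1990, §12.5 p. 182; §3.6] -/
theorem mul_conjLocal_eq_one_of_not_mem_hyperbolicSet (hns : ∀ w : PlacesOver L v, IsCMField.complexConj L • w.1 = w.1) {γ : Gqs L v}
    (hreg : IsRegularElt (γ.val : GL (Fin 3) (LocalRing L v))) (hγ : γ ∉ hyperbolicSet L v) {α : LocalRing L v}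
    (hα : ((γ.val : GL (Fin 3) (LocalRing L v)) : Matrix (Fin 3) (Fin 3) (LocalRing L v)).charpoly.IsRoot α) :
    α * conjLocal L (IsCMField.complexConj L) v α = 1 := by
  by_contra hne
  exact hγ (mem_hyperbolicSet_of_isRoot L v hns hreg hα hne)

end Summit.HodgeConjecture.HodgeConjecture.Cruxes.H413.F0P3cStCharTSHyperbolicSetEigen
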